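import Summits.QuantumFields.QCD.Theorems.QuarksAsStableActionStableActionBridgeStubScalarKernelProps
import Summits.QuantumFields.QCD.Theorems.QuarksAsStableActionStableActionBridgeStubModeNumberSelection
import Summits.QuantumFields.QCD.Theorems.QuarksAsStableActionStableActionBridgeStubEigenspaceSimple
import Summits.QuantumFields.QCD.Theorems.QuarksAsStableActionStableActionBridgeStubSectorOfSimple
import Summits.QuantumFields.QCD.Theorems.QuarksAsStableActionStableActionBridgeStubCardSliceFermiIdx
import Summits.QuantumFields.QCD.Theorems.QuarksAsStableActionStableActionBridgeStubEigenvectorToEigenwave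
import Summits.QuantumFields.QCD.Theorems.QuarksAsStableActionStableActionBridgeStubEigenwaveToEigenvector
import Summits.QuantumFields.QCD.Theorems.QuarksAsStableActionStableActionBridgeStubWaveSector
import Summits.QuantumFields.QCD.Theorems.QuarksAsStableActionStableActionBridgeStubChargeConjMatrixSector
import Summits.QuantumFields.QCD.Theorems.QuarksAsStableActionStableActionBridgeStubChargeConjMatrixIntertwine
import Summits.QuantumFields.QCD.Theorems.QuarksAsStableActionStableActionBridgeStubBondKernelChargeConj
import Summits.QuantumFields.QCD.Theorems.QuarksAsStableActionStableActionBridgeStubTransferWaveChargeConj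
import Summits.QuantumFields.QCD.Theorems.QuarksAsStableActionStableActionBridgeTransferPositivity
import HarnessLib

/-!
# The vacuum of lattice QCD's transfer operator is fermion-even (under simplicity)
(stub `stub_vacuum_even` of line `twisted_trace_transfer`, crux `QuarksAsStableAction.StableActionBridge`, stmt-QuantumFields-9737;
lead assembly of the vacuum-parity clause Q2, cycle 18)

For the scalarised transfer operator `A` (kernel `k = (R B R)_{ss'}`) with a parity-adapted eigenbasis `A bᵢ = λᵢ bᵢ`, `F bᵢ = σᵢ bᵢ`
(`F` = fermion parity `(−1)^{#s}`), a level `λ_{i₀} ≠ 0` that is SIMPLE among the basis levels has `σ_{i₀} = +1`.  Chain of the landed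
sub-goals: the eigenline is `ℂ b_{i₀}` (`stub_eigenspace_simple`); the eigenvector lives a.e. in one mode-number sector `n₀`
(`stub_sector_of_simple`, the kernel conserving `#s` by `stub_modeNumber_selection`); it is `RΨ` for a continuous gauge-invariant
eigenwave `Ψ` (`stub_eigenvector_to_eigenwave`), supported in sector `n₀` EVERYWHERE (`stub_wave_sector`); its charge conjugate
`𝒞Ψ(U) = 𝒱 Ψ(Ū)` (`𝒱 = P_hᴴ Γ(1 ⊗ Cγ₄)`, `stub_chargeConjMatrix_intertwine`, `stub_bondKernel_chargeConj`,
`stub_transferWave_chargeConj`) is again an eigenwave, supported in sector `D₁ − n₀` (`stub_chargeConjMatrix_sector`), hence gives an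
eigenvector (`stub_eigenwave_to_eigenvector`) which by simplicity is a non-zero multiple of `b_{i₀}`: so `n₀ = D₁ − n₀`, `2 n₀ = D₁ =
12 N_f S³` (`stub_card_sliceFermiIdx`), `n₀` is even and `F b_{i₀} = (−1)^{n₀} b_{i₀} = b_{i₀}`.
References: Lüscher 1977 (positivity/sectors of the transfer matrix); Lucini–Patella–Ramos–Tantalo 2016 App. D (charge conjugation).
-/

noncomputable section

namespace Summit.QuantumFields.QCD.Cruxes.StableActionBridge.TwistedTraceTransfer

open MeasureTheory Filter
open scoped InnerProductSpace ComplexConjugate Matrix BigOperators ENNReal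
open Literature.MathematicalPhysics.QuantumFieldTheory Literature.MathematicalPhysics.QuantumLattice
open Literature.Probability.LatticeModels (TorusSite)

/-- **The vacuum is fermion-even (stub `stub_vacuum_even`; Q2).**  For `m_f > −1`, the scalarised transfer kernel `k` of `R = √T̂_F`
(bicommutant square root), a self-adjoint `A` with the a.e. kernel formula, the parity operator `F` (`F φ = (−1)^{#s} φ` a.e.) and a joint
eigenbasis `A bᵢ = λᵢ bᵢ`, `F bᵢ = σᵢ bᵢ`: if `λ_{i₀} ≠ 0` is simple among the `λᵢ` then `σ_{i₀} = 1`. [cite: Luscher1977, pp. 283–292]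
[cite: LuciniEtAl2016, App. D] -/
theorem stub_vacuum_even : ∀ (Nf S : ℕ) [NeZero S] (β : ℝ) (mq : Fin Nf → ℝ), (∀ f, -1 < mq f) →
    ∀ R : GaugeConfig 3 S (Matrix.specialUnitaryGroup (Fin 3) ℂ) → Matrix (Finset (SliceFermiIdx Nf S)) (Finset (SliceFermiIdx Nf S)) ℂ,
    Continuous R → (∀ U, (R U)ᴴ = R U ∧ R U * R U = fermionSliceOp U mq ∧
        ∀ P : Matrix (Finset (SliceFermiIdx Nf S)) (Finset (SliceFermiIdx Nf S)) ℂ,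
          P * fermionSliceOp U mq = fermionSliceOp U mq * P → P * R U = R U * P) →
    ∀ k : GaugeConfig 3 S (Matrix.specialUnitaryGroup (Fin 3) ℂ) × Finset (SliceFermiIdx Nf S) → GaugeConfig 3 S (Matrix.specialUnitaryGroup (Fin 3) ℂ) × Finset (SliceFermiIdx Nf S) → ℂ,
    (∀ y y', k y y' = (R y.1 * (Matrix.of fun a c => ∫ g : TorusSite 3 S → (Matrix.specialUnitaryGroup (Fin 3) ℂ),
          (gaugeSliceKernel β y.1 (gaugeTransform g y'.1) : ℂ) * @fockGaugeAct Nf S _ g a c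
            ∂(Measure.pi fun _ => haarProbability (Matrix.specialUnitaryGroup (Fin 3) ℂ))) * R y'.1) y.2 y'.2) →
    ∀ A : Lp ℂ 2 ((sliceHaar S).prod (Measure.count : Measure (Finset (SliceFermiIdx Nf S)))) →L[ℂ]
        Lp ℂ 2 ((sliceHaar S).prod (Measure.count : Measure (Finset (SliceFermiIdx Nf S)))),
      IsSelfAdjoint A →
      (∀ φ : Lp ℂ 2 ((sliceHaar S).prod (Measure.count : Measure (Finset (SliceFermiIdx Nf S)))),
        (A φ : GaugeConfig 3 S (Matrix.specialUnitaryGroup (Fin 3) ℂ) × Finset (SliceFermiIdx Nf S) → ℂ)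
          =ᵐ[(sliceHaar S).prod (Measure.count : Measure (Finset (SliceFermiIdx Nf S)))]
          fun y => ∫ y', k y y' * φ y' ∂((sliceHaar S).prod (Measure.count : Measure (Finset (SliceFermiIdx Nf S))))) →
    ∀ F : Lp ℂ 2 ((sliceHaar S).prod (Measure.count : Measure (Finset (SliceFermiIdx Nf S)))) →L[ℂ]
        Lp ℂ 2 ((sliceHaar S).prod (Measure.count : Measure (Finset (SliceFermiIdx Nf S)))),
      (∀ φ : Lp ℂ 2 ((sliceHaar S).prod (Measure.count : Measure (Finset (SliceFermiIdx Nf S)))),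
        (F φ : GaugeConfig 3 S (Matrix.specialUnitaryGroup (Fin 3) ℂ) × Finset (SliceFermiIdx Nf S) → ℂ)
          =ᵐ[(sliceHaar S).prod (Measure.count : Measure (Finset (SliceFermiIdx Nf S)))]
          fun y => (((-1 : ℝ) ^ y.2.card : ℝ) : ℂ) * φ y) →
    ∀ (ι : Type) (b : HilbertBasis ι ℂ (Lp ℂ 2 ((sliceHaar S).prod (Measure.count : Measure (Finset (SliceFermiIdx Nf S))))))
      (lam σ : ι → ℝ),
      (∀ i, A (b i) = (lam i : ℂ) • (b i : Lp ℂ 2 ((sliceHaar S).prod (Measure.count : Measure (Finset (SliceFermiIdx Nf S)))))) →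
      (∀ i, F (b i) = (σ i : ℂ) • (b i : Lp ℂ 2 ((sliceHaar S).prod (Measure.count : Measure (Finset (SliceFermiIdx Nf S)))))) →
    ∀ i₀ : ι, lam i₀ ≠ 0 → (∀ i, lam i = lam i₀ → i = i₀) → σ i₀ = 1 := by
  intro Nf S _ β mq hm
  set X := GaugeConfig 3 S (Matrix.specialUnitaryGroup (Fin 3) ℂ) with hXdef
  set Fι := Finset (SliceFermiIdx Nf S) with hFdef
  set ρ : Measure (X × Fι) := (sliceHaar S).prod (Measure.count : Measure Fι) with hρ
  intro R hRc hR k hk A hsa hA F hF ι b lam σ hb hFb i₀ hl0 hsimp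
  haveI hprob : IsProbabilityMeasure (sliceHaar (S := S)) := Sketch.isProbabilityMeasure_sliceHaar S
  haveI : IsFiniteMeasure ρ := by rw [hρ]; infer_instance
  have hR2 : ∀ U, (R U)ᴴ = R U ∧ R U * R U = fermionSliceOp U mq := fun U => ⟨(hR U).1, (hR U).2.1⟩
  obtain ⟨-, hkm, ⟨C, hkC⟩, -, -⟩ := stub_scalarKernel_props Nf S β mq hm R hRc hR k hk
  have hksec : ∀ y y', y.2.card ≠ y'.2.card → k y y' = 0 := stub_modeNumber_selection Nf S β mq hm R hRc hR k hk
  set D₁ := Fintype.card (SliceFermiIdx Nf S) with hD₁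
  -- the eigenvector and its eigenline
  set φ := (b i₀ : Lp ℂ 2 ρ) with hφdef
  have hφ0 : φ ≠ 0 := b.orthonormal.ne_zero i₀
  have hAφ : A φ = (lam i₀ : ℂ) • φ := hb i₀
  have hline : ∀ ψ : Lp ℂ 2 ρ, A ψ = (lam i₀ : ℂ) • ψ → ∃ c : ℂ, ψ = c • φ :=
    fun ψ hψ => ⟨⟪b i₀, ψ⟫_ℂ, stub_eigenspace_simple (Lp ℂ 2 ρ) A hsa ι b lam hb i₀ hsimp ψ hψ⟩
  -- the sector of the eigenvector (a.e.)
  have hnm : Measurable fun y : X × Fι => y.2.card :=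
    (measurable_of_countable fun s : Fι => s.card).comp measurable_snd
  obtain ⟨n₀, hn₀D, hsec⟩ := stub_sector_of_simple (X × Fι) ρ (fun y => y.2.card) D₁ hnm
    (fun y => Finset.card_le_univ _) k C hkm hkC (fun x y h => hksec x y h) A hA φ (lam i₀ : ℂ) hφ0 hAφ hline
  -- the eigenwave `Ψ`, supported in sector `n₀` everywhere
  obtain ⟨Ψ, hΨc, hΨinv, hRΨ, hTΨ⟩ := stub_eigenvector_to_eigenwave Nf S β mq hm R hRc hR2 k hk A hA φ (lam i₀) hl0 hAφ
  obtain ⟨hRsec, hwave⟩ := stub_wave_sector Nf S β mq hm R hRc hR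
  have hΨsec : ∀ (U : X) (s : Fι), s.card ≠ n₀ → Ψ U s = 0 := by
    refine hwave Ψ (lam i₀) n₀ hΨc hl0 hTΨ ?_
    filter_upwards [hRΨ, hsec] with y hy hy' hcard
    rw [hy]; exact hy' hcard
  -- charge conjugation
  set V : Matrix Fι Fι ℂ := (particleHole (fun _ : SliceFermiIdx Nf S => (1 : ℂ)))ᴴ *
    fockLift (Matrix.reindex sliceQuarkEquiv sliceQuarkEquiv
      (sliceKron (1 : Matrix (SliceColourVar Nf S) (SliceColourVar Nf S) ℂ) (chargeConj * euclideanGamma 0))) with hVdef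
  obtain ⟨hVu, hVg, hVT⟩ := stub_chargeConjMatrix_intertwine Nf S mq hm
  have hVB := stub_bondKernel_chargeConj Nf S β V hVg
  set CΨ : SliceWave Nf S := fun U => V *ᵥ Ψ (fun e => suConj 3 (U e)) with hCΨdef
  obtain ⟨hCc, -, hCT⟩ := stub_transferWave_chargeConj Nf S β mq hm V hVu hVg hVT hVB Ψ hΨc
  have hCeig : ∀ (U : X) (a : Fι),
      (∫ U', (((Matrix.of fun a' c => ∫ g : TorusSite 3 S → (Matrix.specialUnitaryGroup (Fin 3) ℂ),
          (gaugeSliceKernel β U (gaugeTransform g U') : ℂ) * @fockGaugeAct Nf S _ g a' c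
            ∂(Measure.pi fun _ => haarProbability (Matrix.specialUnitaryGroup (Fin 3) ℂ))) * fermionSliceOp U' mq) *ᵥ
              CΨ U') a ∂(sliceHaar S)) = (lam i₀ : ℂ) * CΨ U a := by
    intro U a
    rw [hCT U a]
    have hfun : (fun a' => ∫ U', (((Matrix.of fun a'' c => ∫ g : TorusSite 3 S → (Matrix.specialUnitaryGroup (Fin 3) ℂ),
          (gaugeSliceKernel β (fun e => suConj 3 (U e)) (gaugeTransform g U') : ℂ) * @fockGaugeAct Nf S _ g a'' c
            ∂(Measure.pi fun _ => haarProbability (Matrix.specialUnitaryGroup (Fin 3) ℂ))) * fermionSliceOp U' mq) *ᵥ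
              Ψ U') a' ∂(sliceHaar S)) = (lam i₀ : ℂ) • Ψ (fun e => suConj 3 (U e)) :=
      funext fun a' => hTΨ _ a'
    rw [hfun, Matrix.mulVec_smul, Pi.smul_apply, smul_eq_mul]
  -- `CΨ` is supported in sector `D₁ − n₀`
  have hCsec : ∀ (U : X) (s : Fι), s.card ≠ D₁ - n₀ → CΨ U s = 0 := by
    intro U s hs
    refine stub_chargeConjMatrix_sector Nf S (Ψ (fun e => suConj 3 (U e))) n₀ (fun t ht => hΨsec _ t ht) s ?_
    intro h; exact hs (by omega)
  -- the eigenvector of `CΨ` is a multiple of `φ`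
  obtain ⟨φ', hφ'ae, hAφ'⟩ := stub_eigenwave_to_eigenvector Nf S β mq hm R hRc hR2 k hk A hA CΨ (lam i₀) hCc hCeig
  obtain ⟨c, hc⟩ := hline φ' hAφ'
  have hRC : ∀ (U : X) (s : Fι), s.card ≠ D₁ - n₀ → (R U *ᵥ CΨ U) s = 0 :=
    fun U s hs => hRsec U (CΨ U) (D₁ - n₀) (fun t ht => hCsec U t ht) s hs
  -- `c ≠ 0`: otherwise `CΨ ≡ 0`, `Ψ ≡ 0`, `φ = 0`
  have hc0 : c ≠ 0 := by
    intro hc0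
    rw [hc0, zero_smul] at hc
    -- `R CΨ = 0` a.e., hence `CΨ ≡ 0` by the sector lemma with the impossible sector `D₁ + 1`
    have hzero : ∀ (U : X) (s : Fι), s.card ≠ D₁ + 1 → CΨ U s = 0 := by
      refine hwave CΨ (lam i₀) (D₁ + 1) hCc hl0 hCeig ?_
      have h0 : (φ' : X × Fι → ℂ) =ᵐ[ρ] 0 := by rw [hc]; exact Lp.coeFn_zero _ _ _
      filter_upwards [hφ'ae, h0] with y hy hy0 _
      rw [← hy, hy0, Pi.zero_apply]
    have hCΨ0 : ∀ U : X, CΨ U = 0 := fun U => funext fun s => hzero U s (by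
      have := Finset.card_le_univ s; rw [← hD₁] at this; omega)
    have hΨ0 : ∀ U : X, Ψ U = 0 := by
      intro U
      have h := hCΨ0 (fun e => suConj 3 (U e))
      simp only [hCΨdef, suConj_suConj] at h
      have hdet : IsUnit V.det := Matrix.UnitaryGroup.det_isUnit ⟨V, hVu⟩
      have hVunit : IsUnit V := (Matrix.isUnit_iff_isUnit_det V).2 hdet
      exact (Matrix.mulVec_injective_iff_isUnit.2 hVunit) (by rw [h, Matrix.mulVec_zero])
    apply hφ0
    refine Lp.ext ?_
    filter_upwards [hRΨ, Lp.coeFn_zero ℂ 2 ρ] with y hy hy0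
    rw [← hy, hy0, hΨ0 y.1, Matrix.mulVec_zero, Pi.zero_apply, Pi.zero_apply]
  -- hence `φ` vanishes a.e. off sector `D₁ − n₀` as well
  have hsec' : ∀ᵐ y ∂ρ, y.2.card ≠ D₁ - n₀ → (φ : X × Fι → ℂ) y = 0 := by
    have hφc : φ = c⁻¹ • φ' := by rw [hc, smul_smul, inv_mul_cancel₀ hc0, one_smul]
    have hae : (φ : X × Fι → ℂ) =ᵐ[ρ] fun y => c⁻¹ * (φ' : X × Fι → ℂ) y := by
      rw [hφc]; filter_upwards [Lp.coeFn_smul c⁻¹ φ'] with y hy; rw [hy, Pi.smul_apply, smul_eq_mul]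
    filter_upwards [hae, hφ'ae] with y hy hy' hcard
    rw [hy, hy', hRC y.1 y.2 hcard, mul_zero]
  -- the two sectors must coincide
  have hn : n₀ = D₁ - n₀ := by
    by_contra hne
    apply hφ0
    refine Lp.ext ?_
    filter_upwards [hsec, hsec', Lp.coeFn_zero ℂ 2 ρ] with y h1 h2 h0
    rw [h0, Pi.zero_apply]
    by_cases hy : y.2.card = n₀
    · exact h2 (by omega)
    · exact h1 hy
  -- so `n₀ = 6 N_f S³` is even
  have hcard := stub_card_sliceFermiIdx Nf S
  have hx : D₁ = 12 * (Nf * S ^ 3) := by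
    rw [show D₁ = Fintype.card (SliceFermiIdx Nf S) from rfl, hcard]; ring
  have heven : Even n₀ := ⟨3 * (Nf * S ^ 3), by omega⟩
  -- parity of `φ`
  have hFφ : F φ = φ := by
    refine Lp.ext ?_
    filter_upwards [hF φ, hsec] with y hy h1
    rw [hy]
    by_cases hcase : y.2.card = n₀
    · rw [hcase, heven.neg_one_pow]; push_cast; rw [one_mul]
    · rw [h1 hcase, mul_zero]
  have h1 : ((σ i₀ : ℂ) - 1) • φ = 0 := by rw [sub_smul, one_smul, ← hFb i₀]; exact sub_eq_zero.2 hFφ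
  have h2 : (σ i₀ : ℂ) - 1 = 0 := by
    rcases smul_eq_zero.1 h1 with h | h
    · exact h
    · exact absurd h hφ0
  exact_mod_cast sub_eq_zero.1 h2

end Summit.QuantumFields.QCD.Cruxes.StableActionBridge.TwistedTraceTransfer

end
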